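import Summits.HodgeConjecture.HodgeConjecture.Theorems.H413FinCoeffIntegrable
import Summits.HodgeConjecture.HodgeConjecture.Theorems.H413FinPairRepVsOmega
import HarnessLib

/-!
# H413 ∕ E-2 road C — `hF` AT THE CM LINE DATUM (the pin): the finite matrix coefficients of `ω_f^{s}` are INTEGRABLE over
# `U(diag dW)(𝔸_{L⁺,f})`, for EVERY `Φ_f, Ψ_f ∈ 𝒮((𝔸_{L⁺,f})ⁿ)` and every compatible continuous splitting `s`

Crux H413 (stmt-HodgeConjecture-24833), FLOOR 0, programme P4, engine E-2 child line `F0_E2SiegelWeilWeilRange`, conjunct (ii) of `StubSW2`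
(orbital sums of the rational orbit terms, locally uniformly bounded), road C.  ★ `E2SW2OrbitalSums.orbitalSums_bounded_of_finIntegrable'`
(`Theorems/H413E2SW2FinLevelEigen`, F0P2a-p06) reduces (ii) — at a compact archimedean member — to ONE input `hF`: for all additive Haar `μ_f`
on `𝔸_{F,f}ⁿ`, all Haar `μ_b` on `U(J_W)(𝔸_{F,f})` and all `Φ_f, Ψ_f`, the coefficient `b ↦ ⟨R_e ω_f^{s}(1,b) R_e⁻¹ Φ_f, Ψ_f⟩_{μ_f}` is
`μ_b`-integrable.  THIS FILE proves `hF` AT THE CM LINE DATUM `(L⁺, L, c̄, diag dV, diag dW)` of a CM field `L` (`dV`, `dW` real non-zero, `dW` a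
line, `n = N·1 ≥ 3`) for every compatible CONTINUOUS splitting `s` — in particular at the chosen splitting `splittingOf hGR` of the pin:

* **`integrable_finCoeff_cm`** `(h3) (hs) (hsc) … (μ) (μb) (Φf Ψf)` — the `hF` body of ★ `orbitalSums_bounded_of_finIntegrable'` TOKEN FOR TOKEN
  at `(F, E, c, JV, JW, hV, hW, hVd, hWd, hJV, hJW) := (Fp L, L, c̄, diag dV, diag dW, realDiagonal_isSymm …, isUnit_det_realDiagonal …,
  (realDiagonal_map …).symm)` (the letters of `cmSplittingDatum`, as in ★ `H413ChiNFinPin`);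
* **`integrable_finCoeff_cm_splittingOf`** `(h3) (hGR)` — the same at `s := splittingOf hGR`;
* **`hF_cm_splittingOf`** `(h3) (hGR)` — its closure over the measure ∕ test-function binders: the `hF` ARGUMENT of ★
  `orbitalSums_bounded_of_finIntegrable'` at the pin, as ONE term.

Assembly (no displayed row left): ★ `integrable_finCoeff_of_localSplittings` (`Theorems/H413FinCoeffIntegrable`: every
`Φ_f, Ψ_f`, for the place-assembled `Ω` of a restricted family `𝓢` — [Li1992, (27)] Euler product of the `L¹` norms + sesquilinearity) at the
`χ`-line family `𝓢_χ = congrW (undoubledSplittings (cmFinLocalFamily χ))` of a unitary splitting character `χ` (★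
`exists_isUnitary_isSplittingChar_one`; no character is a binder), with the reference rows of ★ `H413ChiNFinPin.exists_finCoeff_ne_zero_cm`
VERBATIM (`hTd := isUnit_det_gram`, `hL2 := isL2Isometric_omegaLoc_congrW_undoubledSplittings_cmFinLocalFamily`, `μ'_v := addHaar`, `ν^W_v :=`
the Haar measure normalised on the compact open `U(diag dW)(𝒪_v)`, `S₀ := {i₀}`), then the CARRIER BRIDGE ★
`integrable_finCoeff_cm_of_integrable_Omega` (`Theorems/H413FinPairRepVsOmega`, F0P4-p03: `R_e ω_f^{s}(1,b) R_e⁻¹ = w(b) • Ω_χ(1 ⊗ b)` with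
`w` continuous unimodular — this is where `Continuous s` is used).  SCOPE: the CM line datum only (the tree instantiates `FinLocalSplittings`
there); the letter-generality `hF` of `StubSW2` is the planners' (A-p17 (g14) 03:01:10Z).  KERNEL: theorems only, DEF-FREE, no `sorry`;
`--supports stmt-HodgeConjecture-24833 --as helper`.  HC_CM is proved only modulo the printed citations until rung 0 closes; nothing printed is
claimed here.

[cite: Li1992, Thm 2.1 (27) p. 184; §5 p. 206] [cite: GelbartRogawski1991, §3.1 Prop. 3.1.1 p. 455 and Remark p. 457 L4–13]
[cite: TateThesis1967, Thm 3.3.1]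
-/

set_option autoImplicit false
set_option linter.dupNamespace false

noncomputable section

open scoped RestrictedProduct ENNReal NNReal ComplexConjugate Matrix Kronecker
open MeasureTheory NumberField IsDedekindDomain Filter Function Set Topology
open Literature.NumberTheory.Automorphic Literature.NumberTheory.Automorphic.UnitaryGroup
open Literature.NumberTheory.Weil1964
open Literature.NumberTheory.GelbartRogawski1991 Literature.NumberTheory.GelbartRogawski1991.UnitaryDualPair
open Literature.NumberTheory.GelbartRogawski1991.UnitaryDualPair.WeilCoinv
open Literature.NumberTheory.GelbartRogawski1991.GRConstruction
open Literature.NumberTheory.Automorphic.Liu2021.Def411WeilCarriersDoubling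
open Literature.RepresentationTheory.HarrisKudlaSweet1996

namespace Summit.HodgeConjecture.HodgeConjecture.Cruxes.H413.ThetaNonvanishing

section CMLine

variable (L : Type) [Field L] [NumberField L] [IsCMField L] {N n : ℕ} (e : Fin N × Fin 1 ≃ Fin n)
  (dV : Fin N → L) (hdV : ∀ i, IsCMField.complexConj L (dV i) = dV i) (hdV0 : ∀ i, dV i ≠ 0)
  (dW : Fin 1 → L) (hdW : ∀ i, IsCMField.complexConj L (dW i) = dW i) (hdW0 : ∀ i, dW i ≠ 0) (h3 : 3 ≤ n)

set_option maxHeartbeats 2000000 in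
-- heartbeats: the instantiation elaborates the `splittingDatum` telescope at the CM data together with the
-- `congrW (undoubledSplittings (cmFinLocalFamily …))` family (as in ★ `exists_finCoeff_ne_zero_cm`, 2 000 000).
include hdV0 hdW0 h3 in
/-- **`hF` AT THE CM LINE DATUM.**  For a CM field `L`, real non-zero `dV : Fin N → L`, a real non-zero line `dW : Fin 1 → L`, `n = N·1 ≥ 3`,
ANY compatible continuous splitting `s` of the CM dual pair `(U(diag dV), U(diag dW))` (`cmSplittingDatum`), any additive Haar measure `μ` on
`(𝔸_{L⁺,f})ⁿ`, any Haar measure `μ_b` on `U(diag dW)(𝔸_{L⁺,f})` and ALL `Φ_f, Ψ_f ∈ 𝒮((𝔸_{L⁺,f})ⁿ)`: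
`b ↦ ∫ y, (R_e (ω_f^{s}(1,b) (R_e⁻¹ Φ_f))) y · conj (Ψ_f y) ∂μ` is `μ_b`-INTEGRABLE — ★ `integrable_finCoeff_of_localSplittings` at the `χ`-line
reference family (all rows as in ★ `exists_finCoeff_ne_zero_cm`) carried to `ω_f^{s}` by ★ `integrable_finCoeff_cm_of_integrable_Omega`.
[cite: Li1992, Thm 2.1 (27) p. 184; §5 p. 206] [cite: GelbartRogawski1991, §3.1 Prop. 3.1.1 p. 455, Remark p. 457 L4–13]
[cite: TateThesis1967, Thm 3.3.1] -/
theorem integrable_finCoeff_cm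
    {s : UnitaryGroup.adelicPair (Fp L) L (IsCMField.complexConj L) N 1 (Matrix.diagonal dV) (Matrix.diagonal dW) →*
      adelicMpCont (Fp L) (Fin n) (adelicGram (Fp L) e (realDiagonal L dV hdV) (realDiagonal L dW hdW))}
    (hs : (cmSplittingDatum L e dV hdV hdV0 dW hdW hdW0).IsCompatible s) (hsc : Continuous s)
    [MeasurableSpace (FiniteAdeleRing (𝓞 (Fp L)) (Fp L))] [BorelSpace (FiniteAdeleRing (𝓞 (Fp L)) (Fp L))]
    (μ : Measure (Fin n → FiniteAdeleRing (𝓞 (Fp L)) (Fp L))) [μ.IsAddHaarMeasure]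
    [MeasurableSpace (UnitaryGroup.finAdelic (Fp L) L (IsCMField.complexConj L) 1 (Matrix.diagonal dW))]
    [BorelSpace (UnitaryGroup.finAdelic (Fp L) L (IsCMField.complexConj L) 1 (Matrix.diagonal dW))]
    (μb : Measure (UnitaryGroup.finAdelic (Fp L) L (IsCMField.complexConj L) 1 (Matrix.diagonal dW))) [μb.IsHaarMeasure]
    (Φf Ψf : FinSB (Fp L) (Fin n)) :
    Integrable (fun b : UnitaryGroup.finAdelic (Fp L) L (IsCMField.complexConj L) 1 (Matrix.diagonal dW) =>
      ∫ y, ((finSBReindex (Fp L) e (finPairRep (Fp L) L (IsCMField.complexConj L) N 1 e (Matrix.diagonal dV) (Matrix.diagonal dW)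
            (complexConj_imagUnit L) (imagUnit_ne_zero L) (imagUnit_mul_self L) (realDiagonal_isSymm L dV hdV)
            (realDiagonal_isSymm L dW hdW) (isUnit_det_realDiagonal L dV hdV hdV0) (isUnit_det_realDiagonal L dW hdW hdW0)
            (realDiagonal_map L dV hdV).symm (realDiagonal_map L dW hdW).symm hs (1, b) ((finSBReindex (Fp L) e).symm Φf)) :
            FinSB (Fp L) (Fin n)) : (Fin n → FiniteAdeleRing (𝓞 (Fp L)) (Fp L)) → ℂ) y *
        conj ((Ψf : (Fin n → FiniteAdeleRing (𝓞 (Fp L)) (Fp L)) → ℂ) y) ∂μ) μb := by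
  classical
  -- a unitary splitting character of `L` (the reference character; it does not appear in the statement)
  obtain ⟨χ, hχu, hχs⟩ := exists_isUnitary_isSplittingChar_one (L := L)
  -- Borel structures and additive Haar measures on the `L⁺_v`
  letI mF : ∀ v : HeightOneSpectrum (𝓞 (Fp L)), MeasurableSpace (v.adicCompletion (Fp L)) := fun v => borel _
  haveI bF : ∀ v : HeightOneSpectrum (𝓞 (Fp L)), BorelSpace (v.adicCompletion (Fp L)) := fun v => ⟨rfl⟩
  -- Borel structures and Haar measures on the `U(diag dW)(L⁺_v)`, normalised on `U(diag dW)(𝒪_v)`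
  haveI hlc : ∀ v : HeightOneSpectrum (𝓞 (Fp L)),
      LocallyCompactSpace (UnitaryGroup.localPi L (IsCMField.complexConj L) 1 (Matrix.diagonal dW) v) :=
    fun v => UnitaryGroup.locallyCompactSpace_localPi L 1 (IsCMField.complexConj L) (Matrix.diagonal dW) v
  haveI hsc2 : ∀ v : HeightOneSpectrum (𝓞 (Fp L)),
      SecondCountableTopology (UnitaryGroup.localPi L (IsCMField.complexConj L) 1 (Matrix.diagonal dW) v) :=
    fun v => UnitaryGroup.secondCountableTopology_localPi L 1 (IsCMField.complexConj L) (Matrix.diagonal dW) v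
  letI mP : ∀ v : HeightOneSpectrum (𝓞 (Fp L)),
      MeasurableSpace (UnitaryGroup.localPi L (IsCMField.complexConj L) 1 (Matrix.diagonal dW) v) := fun v => borel _
  haveI bP : ∀ v : HeightOneSpectrum (𝓞 (Fp L)),
      BorelSpace (UnitaryGroup.localPi L (IsCMField.complexConj L) 1 (Matrix.diagonal dW) v) := fun v => ⟨rfl⟩
  have hKo : ∀ v : HeightOneSpectrum (𝓞 (Fp L)),
      IsOpen (UnitaryGroup.localInt L (IsCMField.complexConj L) 1 (Matrix.diagonal dW) v :
        Set (UnitaryGroup.localPi L (IsCMField.complexConj L) 1 (Matrix.diagonal dW) v)) :=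
    fun v => isOpen_localInt L (IsCMField.complexConj L) 1 (Matrix.diagonal dW) v
  let C : ∀ v : HeightOneSpectrum (𝓞 (Fp L)),
      TopologicalSpace.PositiveCompacts (UnitaryGroup.localPi L (IsCMField.complexConj L) 1 (Matrix.diagonal dW) v) := fun v =>
    { carrier := (UnitaryGroup.localInt L (IsCMField.complexConj L) 1 (Matrix.diagonal dW) v :
        Set (UnitaryGroup.localPi L (IsCMField.complexConj L) 1 (Matrix.diagonal dW) v))
      isCompact' := isCompact_localInt L (IsCMField.complexConj L) 1 (Matrix.diagonal dW) v
      interior_nonempty' := ⟨1, by rw [(hKo v).interior_eq]; exact one_mem _⟩ }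
  let νW : ∀ v : HeightOneSpectrum (𝓞 (Fp L)),
      Measure (UnitaryGroup.localPi L (IsCMField.complexConj L) 1 (Matrix.diagonal dW) v) := fun v => Measure.haarMeasure (C v)
  haveI hνH : ∀ v, (νW v).IsHaarMeasure := fun v => Measure.isHaarMeasure_haarMeasure (C v)
  haveI hνσ : ∀ v, SigmaFinite (νW v) := fun v => by
    haveI : SigmaCompactSpace (UnitaryGroup.localPi L (IsCMField.complexConj L) 1 (Matrix.diagonal dW) v) :=
      sigmaCompactSpace_of_locallyCompact_secondCountable
    infer_instance
  have hB1 : ∀ v : HeightOneSpectrum (𝓞 (Fp L)),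
      νW v (UnitaryGroup.localInt L (IsCMField.complexConj L) 1 (Matrix.diagonal dW) v :
        Set (UnitaryGroup.localPi L (IsCMField.complexConj L) 1 (Matrix.diagonal dW) v)) = 1 :=
    fun v => Measure.haarMeasure_self
  -- a finite place `i₀` (the exceptional set is `{i₀}`)
  obtain ⟨i₀⟩ : Nonempty (HeightOneSpectrum (𝓞 (Fp L))) := by
    obtain ⟨M, hM⟩ := Ideal.exists_maximal (𝓞 (Fp L))
    exact ⟨⟨M, hM.isPrime, Ring.ne_bot_of_isMaximal_of_not_isField hM (RingOfIntegers.not_isField (Fp L))⟩⟩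
  -- `[U(diag dW)]` is compact (a real non-degenerate hermitian line is anisotropic)
  haveI := compactSpace_quotient_range_toAdelic_line L dW hdW hdW0
  -- `diag dW` is a `c̄`-hermitian line
  have hJ₁ : Matrix.diagonal dW 0 0 ≠ 0 := by
    rw [Matrix.diagonal_apply_eq]; exact hdW0 0
  have hJ₁c : ((Matrix.diagonal dW).map (IsCMField.complexConj L))ᵀ = Matrix.diagonal dW := by
    rw [Matrix.diagonal_map (map_zero _), Matrix.diagonal_transpose]
    exact congrArg Matrix.diagonal (funext hdW)
  -- the `Ω_χ`-coefficients are integrable for ALL `Φ_f, Ψ_f` (★ `integrable_finCoeff_of_localSplittings` at the `χ`-line family) …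
  refine integrable_finCoeff_cm_of_integrable_Omega L e dV hdV hdV0 dW hdW hdW0 χ hχu hχs hs hsc μ μb Φf Ψf ?_
  -- … carried to `ω_f^{s}` by the bridge
  exact integrable_finCoeff_of_localSplittings (Fp L) L (IsCMField.complexConj L) N e (Matrix.diagonal dV) (Matrix.diagonal dW) hJ₁
    (complexConj_imagUnit L) (imagUnit_ne_zero L) (imagUnit_mul_self L) _ _ _
    (congrW L e dV hdV (lineW L (realDiagonal L dW hdW)) (complexConj_lineW L (realDiagonal L dW hdW))
      (realDiagonal_lineW L (realDiagonal L dW hdW)) (diagonal_lineW L (realDiagonal L dW hdW) (realDiagonal_map L dW hdW).symm)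
      (undoubledSplittings L e dV hdV hdV0 (lineW L (realDiagonal L dW hdW)) (complexConj_lineW L (realDiagonal L dW hdW))
        (lineW_ne_zero L (realDiagonal L dW hdW) (isUnit_det_realDiagonal L dW hdW hdW0)) χ (borelPlaceMeasure L)
        (cmFinLocalFamily L e dV hdV hdV0 (lineW L (realDiagonal L dW hdW)) (complexConj_lineW L (realDiagonal L dW hdW))
          (lineW_ne_zero L (realDiagonal L dW hdW) (isUnit_det_realDiagonal L dW hdW hdW0)) χ hχs (borelPlaceMeasure L)))
      (realDiagonal_isSymm L dW hdW) (realDiagonal_map L dW hdW).symm)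
    (isUnit_det_gram (Fp L) e (isUnit_det_realDiagonal L dV hdV hdV0) (isUnit_det_realDiagonal L dW hdW hdW0)) h3 hJ₁c
    (fun _ => Measure.addHaar)
    (fun v => isL2Isometric_omegaLoc_congrW_undoubledSplittings_cmFinLocalFamily L e dV hdV hdV0
      (lineW L (realDiagonal L dW hdW)) (complexConj_lineW L (realDiagonal L dW hdW))
      (lineW_ne_zero L (realDiagonal L dW hdW) (isUnit_det_realDiagonal L dW hdW hdW0)) χ hχs (borelPlaceMeasure L) v hχu
      (realDiagonal_lineW L (realDiagonal L dW hdW)) (diagonal_lineW L (realDiagonal L dW hdW) (realDiagonal_map L dW hdW).symm)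
      (realDiagonal_isSymm L dW hdW) (realDiagonal_map L dW hdW).symm Measure.addHaar)
    μ μb νW {i₀} (Finset.mem_singleton_self i₀) (fun v _ => hB1 v) Φf Ψf

set_option maxHeartbeats 800000 in
-- heartbeats: the statement carries the CM `splittingDatum` telescope twice (`splittingOf`, `splittingOf_isCompatible`).
include hdV0 hdW0 h3 in
/-- **`hF` at the CHOSEN splitting `splittingOf hGR`** of a `CompatibleSplitting` witness of the CM datum (the pin: `e := e₁`, `dV := frameD V`,
`dW := lineVec a`, `hGR := hGR₀`): `integrable_finCoeff_cm` at `hs := splittingOf_isCompatible hGR`, `hsc := continuous_splittingOf hGR`.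
[cite: Li1992, Thm 2.1 (27) p. 184; §5 p. 206] [cite: GelbartRogawski1991, §3.1 Prop. 3.1.1 p. 455 L1–3] -/
theorem integrable_finCoeff_cm_splittingOf (hGR : (cmSplittingDatum L e dV hdV hdV0 dW hdW hdW0).CompatibleSplitting)
    [MeasurableSpace (FiniteAdeleRing (𝓞 (Fp L)) (Fp L))] [BorelSpace (FiniteAdeleRing (𝓞 (Fp L)) (Fp L))]
    (μ : Measure (Fin n → FiniteAdeleRing (𝓞 (Fp L)) (Fp L))) [μ.IsAddHaarMeasure]
    [MeasurableSpace (UnitaryGroup.finAdelic (Fp L) L (IsCMField.complexConj L) 1 (Matrix.diagonal dW))]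
    [BorelSpace (UnitaryGroup.finAdelic (Fp L) L (IsCMField.complexConj L) 1 (Matrix.diagonal dW))]
    (μb : Measure (UnitaryGroup.finAdelic (Fp L) L (IsCMField.complexConj L) 1 (Matrix.diagonal dW))) [μb.IsHaarMeasure]
    (Φf Ψf : FinSB (Fp L) (Fin n)) :
    Integrable (fun b : UnitaryGroup.finAdelic (Fp L) L (IsCMField.complexConj L) 1 (Matrix.diagonal dW) =>
      ∫ y, ((finSBReindex (Fp L) e (finPairRep (Fp L) L (IsCMField.complexConj L) N 1 e (Matrix.diagonal dV) (Matrix.diagonal dW)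
            (complexConj_imagUnit L) (imagUnit_ne_zero L) (imagUnit_mul_self L) (realDiagonal_isSymm L dV hdV)
            (realDiagonal_isSymm L dW hdW) (isUnit_det_realDiagonal L dV hdV hdV0) (isUnit_det_realDiagonal L dW hdW hdW0)
            (realDiagonal_map L dV hdV).symm (realDiagonal_map L dW hdW).symm (splittingOf_isCompatible (Fp L) L (IsCMField.complexConj L) N 1 e (Matrix.diagonal dV) (Matrix.diagonal dW)
              (complexConj_imagUnit L) (imagUnit_ne_zero L) (imagUnit_mul_self L) (realDiagonal_isSymm L dV hdV)
              (realDiagonal_isSymm L dW hdW) (isUnit_det_realDiagonal L dV hdV hdV0) (isUnit_det_realDiagonal L dW hdW hdW0)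
              (realDiagonal_map L dV hdV).symm (realDiagonal_map L dW hdW).symm hGR) (1, b) ((finSBReindex (Fp L) e).symm Φf)) :
            FinSB (Fp L) (Fin n)) : (Fin n → FiniteAdeleRing (𝓞 (Fp L)) (Fp L)) → ℂ) y *
        conj ((Ψf : (Fin n → FiniteAdeleRing (𝓞 (Fp L)) (Fp L)) → ℂ) y) ∂μ) μb :=
  integrable_finCoeff_cm L e dV hdV hdV0 dW hdW hdW0 h3
    (splittingOf_isCompatible (Fp L) L (IsCMField.complexConj L) N 1 e (Matrix.diagonal dV) (Matrix.diagonal dW)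
              (complexConj_imagUnit L) (imagUnit_ne_zero L) (imagUnit_mul_self L) (realDiagonal_isSymm L dV hdV)
              (realDiagonal_isSymm L dW hdW) (isUnit_det_realDiagonal L dV hdV hdV0) (isUnit_det_realDiagonal L dW hdW hdW0)
              (realDiagonal_map L dV hdV).symm (realDiagonal_map L dW hdW).symm hGR)
    (continuous_splittingOf (Fp L) L (IsCMField.complexConj L) N 1 e (Matrix.diagonal dV) (Matrix.diagonal dW)
              (complexConj_imagUnit L) (imagUnit_ne_zero L) (imagUnit_mul_self L) (realDiagonal_isSymm L dV hdV)
              (realDiagonal_isSymm L dW hdW) (isUnit_det_realDiagonal L dV hdV hdV0) (isUnit_det_realDiagonal L dW hdW hdW0)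
              (realDiagonal_map L dV hdV).symm (realDiagonal_map L dW hdW).symm hGR)
    μ μb Φf Ψf

set_option maxHeartbeats 800000 in
-- heartbeats: as above.
include hdV0 hdW0 h3 in
/-- **THE `hF` ARGUMENT OF ★ `orbitalSums_bounded_of_finIntegrable'` AT THE PIN, AS ONE TERM**: the closure of `integrable_finCoeff_cm_splittingOf`
over the σ-algebra ∕ measure ∕ test-function binders, in the binder's order and shape.
[cite: Li1992, Thm 2.1 (27) p. 184; §5 p. 206] [cite: TateThesis1967, Thm 3.3.1] -/
theorem hF_cm_splittingOf (hGR : (cmSplittingDatum L e dV hdV hdV0 dW hdW hdW0).CompatibleSplitting) :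
    ∀ [MeasurableSpace (FiniteAdeleRing (𝓞 (Fp L)) (Fp L))] [BorelSpace (FiniteAdeleRing (𝓞 (Fp L)) (Fp L))]
      (μf : Measure (Fin n → FiniteAdeleRing (𝓞 (Fp L)) (Fp L))) [μf.IsAddHaarMeasure]
      [MeasurableSpace (UnitaryGroup.finAdelic (Fp L) L (IsCMField.complexConj L) 1 (Matrix.diagonal dW))]
      [BorelSpace (UnitaryGroup.finAdelic (Fp L) L (IsCMField.complexConj L) 1 (Matrix.diagonal dW))]
      (μb : Measure (UnitaryGroup.finAdelic (Fp L) L (IsCMField.complexConj L) 1 (Matrix.diagonal dW))) [μb.IsHaarMeasure]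
      (Φf Ψf : FinSB (Fp L) (Fin n)),
      Integrable (fun b : UnitaryGroup.finAdelic (Fp L) L (IsCMField.complexConj L) 1 (Matrix.diagonal dW) =>
        ∫ y, ((finSBReindex (Fp L) e (finPairRep (Fp L) L (IsCMField.complexConj L) N 1 e (Matrix.diagonal dV) (Matrix.diagonal dW)
            (complexConj_imagUnit L) (imagUnit_ne_zero L) (imagUnit_mul_self L) (realDiagonal_isSymm L dV hdV)
            (realDiagonal_isSymm L dW hdW) (isUnit_det_realDiagonal L dV hdV hdV0) (isUnit_det_realDiagonal L dW hdW hdW0)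
            (realDiagonal_map L dV hdV).symm (realDiagonal_map L dW hdW).symm (splittingOf_isCompatible (Fp L) L (IsCMField.complexConj L) N 1 e (Matrix.diagonal dV) (Matrix.diagonal dW)
              (complexConj_imagUnit L) (imagUnit_ne_zero L) (imagUnit_mul_self L) (realDiagonal_isSymm L dV hdV)
              (realDiagonal_isSymm L dW hdW) (isUnit_det_realDiagonal L dV hdV hdV0) (isUnit_det_realDiagonal L dW hdW hdW0)
              (realDiagonal_map L dV hdV).symm (realDiagonal_map L dW hdW).symm hGR) (1, b) ((finSBReindex (Fp L) e).symm Φf)) : FinSB (Fp L) (Fin n)) : (Fin n → FiniteAdeleRing (𝓞 (Fp L)) (Fp L)) → ℂ) y *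
          conj ((Ψf : (Fin n → FiniteAdeleRing (𝓞 (Fp L)) (Fp L)) → ℂ) y) ∂μf) μb :=
  fun μf _ _ _ μb _ Φf Ψf => integrable_finCoeff_cm_splittingOf L e dV hdV hdV0 dW hdW hdW0 h3 hGR μf μb Φf Ψf

end CMLine

end Summit.HodgeConjecture.HodgeConjecture.Cruxes.H413.ThetaNonvanishing

end
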